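import Summits.ResolutionOfSingularities.ResolutionOfSingularities.Theorems.UniformComplexityCampaignW82SpecializationByName
import Mathlib.RingTheory.AlgebraicIndependent.TranscendenceBasis
import Mathlib.FieldTheory.IntermediateField.Adjoin.Algebra
import HarnessLib

/-!
# Crux `PrimeModelTransfer` (stmt-ResolutionOfSingularities-8933), door 2 of slot W8.2:
# the transcendence-degree-one climb `CampaignW82.ClimbAlgClosed`, by name

Route `ResolutionOfSingularities/UniformComplexity`. The typer's OURS statement
`CampaignW82.ClimbAlgClosed p` (Theorems/UniformComplexityCampaignW82SpecializationNormalForms.lean,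
p481773: for `M` algebraically closed of characteristic `p` with resolution, resolution over
every algebraically closed `M`-algebra `K` with `Algebra.trdeg M K ≤ 1`) is here placed in the
chain of equivalent normal forms of the crux's `p`-slice:

* `trdeg_algebraicClosure_adjoin_simple_le_one` — `trdeg_M ((M(t))^{alg} ∩ K) ≤ 1` (Mathlib
  `trdeg_le_cardinalMk` after transporting algebraicity from `M[t] ⊆ K` to
  `M[t] ⊆ (M(t))^{alg} ∩ K`);
* `climbAlgClosedStep_of_climbAlgClosed`, `climbAlgClosed_of_algClosedAllOrNothing` (pure logic),
  and the equivalences `climbAlgClosed_iff_climbAlgClosedStep`,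
  `primeModelTransferAt_iff_climbAlgClosed` for prime `p` (through
  `algClosedAllOrNothing_iff_climbAlgClosedStep`, p488474).

[OURS · LADDER-RESOLUTION L1, slot W8.2 (prime-field / universality transfer), door 2
UniformComplexity] By-name links; NOT statements of, and attributing nothing to, Hironaka's 2017
manuscript. AI-written; weaker than expert review.
-/

noncomputable section

set_option linter.dupNamespace false -- mandated namespace of this single-conjunct summit

open CategoryTheory CategoryTheory.Limits AlgebraicGeometry TopologicalSpace
open Literature.AlgebraicGeometry.Resolution
open scoped Cardinal IntermediateField.algebraAdjoinAdjoin

namespace Summit.ResolutionOfSingularities.ResolutionOfSingularities.Theorems.CampaignW82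

/-- **`trdeg_M ((M(t))^{alg} ∩ K) ≤ 1`**: the algebraic closure `A` of `M(t)` in a field `K ⊇ M`
has transcendence degree at most one over `M` — `A` is algebraic over `M[t] ⊆ A` (it is algebraic
over `M(t)`, which is algebraic over `M[t]`), so Mathlib's `trdeg_le_cardinalMk` applies to the
one-element generating set `{t}`. [folklore] -/
theorem trdeg_algebraicClosure_adjoin_simple_le_one (M : Type) [Field M] (K : Type) [Field K]
    [Algebra M K] (t : K) :
    Algebra.trdeg M (algebraicClosure (IntermediateField.adjoin M ({t} : Set K)) K) ≤ 1 := by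
  classical
  let E : IntermediateField M K := IntermediateField.adjoin M ({t} : Set K)
  let A : IntermediateField E K := algebraicClosure E K
  let D : Subalgebra M K := Algebra.adjoin M ({t} : Set K)
  -- `A` is algebraic over `D = M[t] ⊆ K` (through `E = M(t)`)
  letI : Algebra D A := ((algebraMap E A).comp (algebraMap D E)).toAlgebra
  haveI : IsScalarTower D E A := IsScalarTower.of_algebraMap_eq fun _ => rfl
  haveI : Algebra.IsAlgebraic E A := algebraicClosure.isAlgebraic E K
  haveI : Algebra.IsAlgebraic D A := Algebra.IsAlgebraic.trans D E A
  -- the generator `t` as an element of `A`, and `D' = M[t] ⊆ A`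
  have htE : t ∈ E := IntermediateField.mem_adjoin_simple_self M t
  let t' : A := ⟨t, by
    have := A.algebraMap_mem (⟨t, htE⟩ : E)
    simpa using this⟩
  let D' : Subalgebra M A := Algebra.adjoin M ({t'} : Set A)
  -- `val : A → K` maps `D'` onto `D`
  let v : A →ₐ[M] K := (A.val).restrictScalars M
  have hvt : v t' = t := rfl
  have hmap : D'.map v = D := by
    change (Algebra.adjoin M ({t'} : Set A)).map v = Algebra.adjoin M ({t} : Set K)
    rw [AlgHom.map_adjoin, Set.image_singleton, hvt]
  have hmem : ∀ d' : D', ((v : A →+* K).comp (D'.val : D' →+* A)) d' ∈ D := fun d' => by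
    rw [← hmap]; exact Subalgebra.mem_map.mpr ⟨d', d'.2, rfl⟩
  let f : D' →+* D := ((v : A →+* K).comp (D'.val : D' →+* A)).codRestrict D hmem
  have hf : Function.Surjective f := by
    rintro ⟨d, hd⟩
    rw [← hmap] at hd
    obtain ⟨a, ha, rfl⟩ := Subalgebra.mem_map.mp hd
    exact ⟨⟨a, ha⟩, Subtype.ext rfl⟩
  have hcomp : (algebraMap D A).comp f = (RingHom.id A).comp (algebraMap D' A) :=
    RingHom.ext fun d' => Subtype.ext rfl
  haveI : Algebra.IsAlgebraic D' A :=
    Algebra.IsAlgebraic.of_ringHom_of_comp_eq f (RingHom.id A) hf Function.injective_id hcomp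
  -- Mathlib: `trdeg R A ≤ #s` when `A` is algebraic over `adjoin R s`
  have h := Algebra.IsAlgebraic.trdeg_le_cardinalMk M ({t'} : Set A)
  simpa using h

/-- **`ClimbAlgClosed p → ClimbAlgClosedStep p`**: the one-step climb to `(M(t))^{alg} ∩ K` is an
instance of the transcendence-degree-one climb (`trdeg_algebraicClosure_adjoin_simple_le_one`).
[folklore] -/
theorem climbAlgClosedStep_of_climbAlgClosed {p : ℕ} (h : ClimbAlgClosed p) :
    ClimbAlgClosedStep p := by
  intro M _ _ _ hM K _ _ _ t X f hs hl hq hX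
  haveI : IsAlgClosed (algebraicClosure (IntermediateField.adjoin M ({t} : Set K)) K) :=
    IsAlgClosure.isAlgClosed (IntermediateField.adjoin M ({t} : Set K))
  exact h M hM (algebraicClosure (IntermediateField.adjoin M ({t} : Set K)) K)
    (trdeg_algebraicClosure_adjoin_simple_le_one M K t) X f hs hl hq hX

/-- **`AlgClosedAllOrNothing p → ClimbAlgClosed p`** (pure logic: the target is algebraically
closed of characteristic `p`). [folklore] -/
theorem climbAlgClosed_of_algClosedAllOrNothing {p : ℕ} (h : AlgClosedAllOrNothing p) :
    ClimbAlgClosed p := by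
  intro M _ _ _ hM K _ _ _ _ X f hs hl hq hX
  haveI : CharP K p := charP_of_injective_algebraMap (algebraMap M K).injective p
  exact h M hM K X f hs hl hq hX

/-- **`ClimbAlgClosed p ⟺ ClimbAlgClosedStep p`** for prime `p` (via the all-or-nothing form,
`algClosedAllOrNothing_iff_climbAlgClosedStep`, p488474). [folklore] -/
theorem climbAlgClosed_iff_climbAlgClosedStep {p : ℕ} (hp : p.Prime) :
    ClimbAlgClosed p ↔ ClimbAlgClosedStep p :=
  ⟨climbAlgClosedStep_of_climbAlgClosed, fun h =>
    climbAlgClosed_of_algClosedAllOrNothing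
      ((algClosedAllOrNothing_iff_climbAlgClosedStep hp).mpr h)⟩

/-- **`PrimeModelTransferAt p ⟺ ClimbAlgClosed p`** for prime `p`: the crux's `p`-slice is the
transcendence-degree-one climb between algebraically closed fields. [folklore] -/
theorem primeModelTransferAt_iff_climbAlgClosed {p : ℕ} (hp : p.Prime) :
    PrimeModelTransferAt p ↔ ClimbAlgClosed p :=
  (primeModelTransferAt_iff_climbAlgClosedStep hp).trans
    (climbAlgClosed_iff_climbAlgClosedStep hp).symm

end Summit.ResolutionOfSingularities.ResolutionOfSingularities.Theorems.CampaignW82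

end
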